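import Summits.MatrixMultiplication.OmegaCensus.STPP222SqNone_5_5A

/-!
# ω-census, the pattern `(2,2,2)²`: NOT in `ZMod 5 × ZMod 5` — search chunks, part C

HONEST FRAMING (pub-omega census; verbatim): lottery ticket; floor = certified bounds/negative ranges.
Census STRUCTURE bookkeeping (Q7 row `k = 2`), not progress on `ω`.  Kernel search chunks 9–10 of 11 for
`STPP222SqNone_5_5.lean` (data `E5_5` / `el5_5` from part A; method in part A's docstring).
-/

open Literature.Computability.AlgebraicComplexity Finset

namespace Summit.MatrixMultiplication.OmegaCensus

namespace STPP222SqNeg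

/-- Start triples, chunk 9 (1 starts, 39814 clause evaluations). [folklore] -/
def reps5_5_9 : List ((ℕ × ℕ) × (ℕ × ℕ) × (ℕ × ℕ) × List (ℕ × ℕ)) :=
  [((0, 1), (1, 0), (2, 0), [(2, 3), (2, 4), (3, 0), (3, 1), (3, 2), (3, 3), (3, 4), (4, 0), (4, 1), (4, 2), (4, 3), (4, 4)])]

/-- Kernel search, chunk 9. [folklore] -/
theorem search5_5_9 : searchB E5_5.ops el5_5 E5_5.key reps5_5_9 = true := by
  decide +kernel

/-- Start triples, chunk 10 (1 starts, 49695 clause evaluations). [folklore] -/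
def reps5_5_10 : List ((ℕ × ℕ) × (ℕ × ℕ) × (ℕ × ℕ) × List (ℕ × ℕ)) :=
  [((0, 1), (1, 0), (2, 1), el5_5)]

/-- Kernel search, chunk 10. [folklore] -/
theorem search5_5_10 : searchB E5_5.ops el5_5 E5_5.key reps5_5_10 = true := by
  decide +kernel

end STPP222SqNeg

end Summit.MatrixMultiplication.OmegaCensus
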